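import Literature.NumberTheory.EllipticCurves.BhargavaSkinnerZhang2014.PiecesFiveAdicCriteriaProofs
import Literature.NumberTheory.EllipticCurves.BhargavaSkinnerZhang2014.PiecesClassTheoremsProofs
import Literature.NumberTheory.EllipticCurves.LeadingTermBSZRankZeroLegProofs
import Literature.NumberTheory.EllipticCurves.BSDRankZeroDensityProofs
import HarnessLib

/-!
# `bsz_rankLeOne_cRank_of_facts`: the rank part of BSD for at least `66.85 %` of elliptic curves
# over `ℚ` ordered by height, BELOW NAMED FACTS ONLY — the re-keyed final assembly

Theorems only (no definition, no named fact; D-0014 / D-0026, debt `+0`).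

This file composes three landed pieces of kernel glue and adds nothing of its own:

* the DENSITY SIDE `Pieces.heightDensityGE_satisfiesBSDRankLeOne_cRank`
  (`BhargavaSkinnerZhang2014/PiecesFiveAdicCriteriaProofs.lean`, Part 3): the theorem of record
  `bsz_rankLeOne_cRank_of_pieces` (`LeadingTermBSZResCellAssemblyProofs.lean`; M. Bhargava,
  C. Skinner, W. Zhang, arXiv:1407.1826v2, proof of Cor. 26, pp. 10–13, with a fourth piece
  counted through M. Bhargava, C. Skinner, J. Ramanujan Math. Soc. 29 (2014), Thm. 7 (ii) /
  Lemma 16) instantiated on the pieces `S₀ := Pieces.S₀`, `T := Pieces.S₁'`, `R := Pieces.T₅`,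
  `P := Pieces.SP' K`, `S₁ := Pieces.S₁Cond`, `W := Pieces.W₅`, `Z := Pieces.Z v` of
  `BhargavaSkinnerZhang2014/Pieces.lean`, with EVERY counting / density binder discharged below
  the named facts A230 (Tate), Duke 1997, A331 ([BSZ] Thm 16 / [BS5] §5 as constructed), A329
  ([BS14] Thm 7 (ii) + Prop 12), A330 ([BS5] Thm 31);
* the CLASS THEOREMS ON THE PIECES `Pieces.h9_pieces`, `Pieces.hker_pieces`,
  `Pieces.hWtors_pieces`, `Pieces.h5_pieces_multiplicative`, `Pieces.W₅.irreducible`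
  (`BhargavaSkinnerZhang2014/PiecesClassTheoremsProofs.lean`, row `eisenstein-p2`);
* the GOOD-ORDINARY LEG of `h5`, `bsz_h5_goodOrdinary_five_of_mainConjecture`, and the two-leg
  form below Skinner 2016 Thm C (2), `bsz_h5_five_of_thmC2`
  (`LeadingTermBSZRankZeroLegProofs.lean`, row `additive-p1`),

into

* **`bsz_rankLeOne_cRank_of_facts`** — `HeightDensityGE SatisfiesBSDRankLeOne
  (3059480216411717 / 4576171406400000)` (`= 0.66856766…`) whose hypotheses are EXACTLY: the named
  facts `hGZK` (A18, Gross–Zagier–Kolyvagin), `hpar` (the `p`-parity theorem AS PRINTED,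
  Dokchitser–Dokchitser 2010 Thm 1.4 = the tree's `p_parity`; the capstone's binder `hDD` = [BSZ]
  Thm 15 is derived from it and `hCT` by `even_selmerRank_sub_torsionRank_iff_of_facts`), `hTate`
  (A230), `hD` (Duke 1997 Thm 1), `h16d` (A331), `h7` (A329), `h31` (A330); for `h5`'s
  good-ordinary leg `hmod` (modularity, `exists_isNewformOf`), `hMC` (Burungale–Castella–Skinner
  2025 Thm 1.1.2 (a), cyclotomic main conjecture), `hS` (Schneider 1985 / Perrin-Riou, order of
  the characteristic power series); for `h5`'s multiplicative leg `hmod'`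
  (`nonempty_modularParametrizationData`), `hA` (Skinner 2016 Thm A, A31), `hGs` / `hGn`
  (Greenberg 1999 §4 formulas, A236 / A235), `hGS` (Greenberg–Stevens at `5`); for `h9` `hZ`
  (W. Zhang 2014 Thm 1.4 (i), A322), `hSZ` (Skinner–Zhang 2014 Thm 1.1 — an OPEN preprint claim,
  «literal-PRE», A326) and `hCT` (Cassels–Tate, A24); and ONE ANONYMOUS per-curve binder `hKim`
  (the rank-`1` converse under the local condition `#Z = 1` on `SP' K ∩ W₅`: C.-H. Kim, Math. Ann.
  387 (2023) Thm 1.1 at the MULTIPLICATIVE prime `5` with (IMC[1/p]) — not typable as printed in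
  today's tree, cell book G3); the auxiliary parameters `K ≥ 8` (truncation level of `P = SP'_K`)
  and `v ∋ 5` (the place of `ℚ` at which `Z = ker res_v` is taken) are those of the capstone;
* **`bsz_rankLeOne_cRank_of_facts_of_thmC`** — the same with BOTH legs of `h5` below ONE
  hypothesis `hC` = Skinner 2016 Thm C clause (2) AS PRINTED (registry A324,
  `Skinner2016.thmC_one_le_selmerCorank_of_L_one_eq_zero`) in place of
  `hmod hMC hS hmod' hA hGs hGn hGS` ([BSZ] Rem. 8: Thm 5 "is … a consequence of … [SU] and
  [Smult]");
* **`bsz_rankLeOne_cRank_of_facts_of_thmC_K8`** — the same at `K = 8` with the place `v ∋ 5`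
  taken inside (`exists_heightOneSpectrum_five_mem`) and `hKim` quantified over every such `v`.

`h5` on `S₀ ∩ W₅` is assembled from its two legs by the case split `5 ∣ 4A³ + 27B²`
(multiplicative at `5`, [BSZ] Lemma 17) / `5 ∤ 4A³ + 27B²` (good ordinary at `5`, since `5 ∤ A` on
`S₀`), with (irr) from (sur) on `W₅` (`Pieces.W₅.irreducible`) and the (ram) prime from `W₅`'s two
(`Pieces.W₅.one_ramified`).

AS-USED vs AS-PRINTED, and status: exactly as in the three composed files — nothing is re-read
here. HONEST FRAMING: kernel bookkeeping between landed theorems and NAMED inputs, one of them an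
OPEN preprint claim (`hSZ`) and one an anonymous binder (`hKim`); nothing is booked; no density
number of record, RESIDUAL-MAP mark, tier, K1 word or status word moves by this file; this is not
"finishing BSD". BSD-DENSITY SPRINT (cell `b2b-bsdres`, book `cells/density/CONVERSION-QUEUE.md`
§1 / §3, `cells/density/C0-SPEC.md` §3): the D2 item `bsz_rankLeOne_cRank_of_facts`, written as
D2-interim by the cell lead.

## References

* [BhargavaSkinnerZhang2014] M. Bhargava, C. Skinner, W. Zhang, *A majority of elliptic curves over
  `ℚ` satisfy the Birch and Swinnerton-Dyer conjecture*, arXiv:1407.1826v2 (2014): Thm. 5, Rem. 8,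
  Thm. 9 (§2.1–2.2, p. 5), §3.1–3.2 (p. 8), Thm. 16, Lemmas 17–20 (pp. 8–10), display (2) (p. 10),
  Cor. 26 and its proof (pp. 10–13).
* [BhargavaSkinner2014] M. Bhargava, C. Skinner, J. Ramanujan Math. Soc. 29 (2014) 221–242:
  Thm. 7 (ii), Prop. 12, Lemma 16.
* [BhargavaShankar5Selmer2013] M. Bhargava, A. Shankar, arXiv:1312.7859: Thm. 31, §5.
* [Skinner2016PacificMC] C. Skinner, Pacific J. Math. 283 (2016) 171–200: Thm. A, Thm. C (p. 173).
* [WZhang2014] W. Zhang, Camb. J. Math. 2 (2014) 191–253: Thm. 1.4 (i).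
* [SkinnerZhang2014] C. Skinner, W. Zhang, arXiv:1407.1099v1: Thm. 1.1 — PREPRINT.
* [BurungaleCastellaSkinner2025] A. Burungale, F. Castella, C. Skinner, arXiv:2405.00270:
  Thm. 1.1.2 (a).
* [DokchitserDokchitserAnnals2010] T. Dokchitser, V. Dokchitser, Ann. of Math. 172 (2010): Thm. 1.4
  (the `p`-parity theorem over `ℚ`).
* [Kim2022] C.-H. Kim, *On the soft p-converse to a theorem of Gross–Zagier and Kolyvagin*, Math.
  Ann. 387 (2023) 1961–1968: Thm. 1.1 (the anonymous binder `hKim`).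
-/

set_option autoImplicit false

noncomputable section

open scoped Classical
open scoped AddSubgroup

open WeierstrassCurve NumberField IsDedekindDomain
open Literature.NumberTheory.EllipticCurves.ModularForms
open Literature.NumberTheory.EllipticCurves.BhargavaSkinner2014
open Literature.NumberTheory.EllipticCurves.BhargavaShankar5Selmer2013

namespace Literature.NumberTheory.EllipticCurves.BhargavaSkinnerZhang2014

open Pieces

/-! ### The place of `ℚ` above `5` -/

/-- There is a finite place `v` of `ℚ` with `5 ∈ 𝔭_v` (the prime `(5)` of `𝓞 ℚ = ℤ`, via Mathlib's
`Rat.HeightOneSpectrum.primesEquiv : HeightOneSpectrum (𝓞 ℚ) ≃ Nat.Primes`). [folklore] -/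
private theorem exists_heightOneSpectrum_five_mem :
    ∃ v : HeightOneSpectrum (𝓞 ℚ), ((5 : ℕ) : 𝓞 ℚ) ∈ v.asIdeal := by
  refine ⟨Rat.HeightOneSpectrum.primesEquiv.symm ⟨5, Nat.prime_five⟩, ?_⟩
  change ((5 : ℕ) : 𝓞 ℚ) ∈
    (Ideal.span {((5 : ℕ) : ℤ)}).map (Rat.IsIntegralClosure.intEquiv (𝓞 ℚ)).symm
  have h : (Rat.IsIntegralClosure.intEquiv (𝓞 ℚ)).symm ((5 : ℕ) : ℤ) = ((5 : ℕ) : 𝓞 ℚ) :=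
    map_natCast _ 5
  rw [← h]
  exact Ideal.mem_map_of_mem _ (Ideal.mem_span_singleton_self _)

/-! ### The binder `h5` on `S₀ ∩ W₅`, both legs -/

/-- **The binder `h5` of `bsz_rankLeOne_cRank_of_pieces` on `S₀ := Pieces.S₀`, `W := Pieces.W₅`,
BOTH LEGS, below the main conjectures**: for `(A, B)` in the height family with `5 ∤ A`,
`E_{A,B} ∈ W₅` and `#Sel^(5)(E_{A,B}/ℚ) = 1`, `rank E_{A,B}(ℚ) = 0 ∧ ord_{s=1} L(E_{A,B}, s) = 0`
— by the case split of [BSZ] Lemma 17: `5 ∣ 4A³ + 27B²` (multiplicative at `5`: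
`Pieces.h5_pieces_multiplicative` below `hmod'`, `hA`, `hGs`, `hGn`, `hGS`) or `5 ∤ 4A³ + 27B²`
(good ordinary at `5`: `bsz_h5_goodOrdinary_five_of_mainConjecture` below `hmod`, `hMC`, `hS`,
with (irr) from (sur) on `W₅`).
[cite: BhargavaSkinnerZhang2014, Thm. 5 and Rem. 8 (§2.1, p. 5), Lemma 17 (p. 8), Lemma 20 (p. 10)]
[cite: BurungaleCastellaSkinner2025, Thm. 1.1.2 (a)] [cite: Skinner2016PacificMC, Thm. A (§1)] -/
theorem Pieces.h5_pieces_of_mainConjectures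
    (hmod : exists_isNewformOf)
    (hMC : burungale_castella_skinner_charIdeal_eq_padicLFunction)
    (hS : Schneider1985_order_charGenerator)
    (hmod' : nonempty_modularParametrizationData)
    (hA : Skinner2016.thmA_charIdeal_multiplicative)
    (hGs : Greenberg1999.thm41Analogue_charValue_rankZero_split_baseChange_anyPrime)
    (hGn : Greenberg1999.thm41Analogue_charValue_rankZero_numberField_anyPrime)
    (hGS : haveI : Fact (Nat.Prime 5) := ⟨Nat.prime_five⟩
      ∀ (V : WeierstrassCurve ℚ) [V.IsElliptic] [V.IsGloballyMinimal],
        greenberg_stevens (W := V) (p := 5)) :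
    ∀ AB : ℤ × ℤ, IsInHeightFamily AB → S₀ AB → W₅ AB →
      Nat.card ((shortWeierstrass AB).selmerGroup 5) = 1 →
        (shortWeierstrass AB).mordellWeilRank = 0 ∧ (shortWeierstrass AB).analyticRank = 0 := by
  haveI : Fact (Nat.Prime 5) := ⟨Nat.prime_five⟩
  intro AB hfam h₀ hW hSel
  by_cases hD : (5 : ℤ) ∣ 4 * AB.1 ^ 3 + 27 * AB.2 ^ 2
  · exact h5_pieces_multiplicative hmod' hA hGs hGn hGS AB hfam h₀ hW hD hSel
  · exact bsz_h5_goodOrdinary_five_of_mainConjecture hmod hMC hS hfam h₀ hD (hW.irreducible hfam)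
      hSel

/-- **The binder `h5` on `S₀ ∩ W₅`, BOTH LEGS, below ONE hypothesis = Skinner 2016 Thm C clause (2)
AS PRINTED** (registry A324, `Skinner2016.thmC_one_le_selmerCorank_of_L_one_eq_zero`; [BSZ] Rem. 8):
`bsz_h5_five_of_thmC2` with (irr) from (sur) and the (ram) prime `ℓ > 5`, `5 ∤ ord_ℓ(4A³ + 27B²)`
from `W₅` (`Pieces.W₅.one_ramified`).
[cite: BhargavaSkinnerZhang2014, Thm. 5, Rem. 7 and Rem. 8 (§2.1, p. 5), Lemma 20 (p. 10)]
[cite: Skinner2016PacificMC, Thm. C (§1, p. 173), second clause] -/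
theorem Pieces.h5_pieces_of_thmC (hC : Skinner2016.thmC_one_le_selmerCorank_of_L_one_eq_zero) :
    ∀ AB : ℤ × ℤ, IsInHeightFamily AB → S₀ AB → W₅ AB →
      Nat.card ((shortWeierstrass AB).selmerGroup 5) = 1 →
        (shortWeierstrass AB).mordellWeilRank = 0 ∧ (shortWeierstrass AB).analyticRank = 0 :=
  fun _ hfam h₀ hW hSel ↦
    bsz_h5_five_of_thmC2 hC hfam h₀ (hW.irreducible hfam) hW.one_ramified hSel

/-! ### The final assembly -/

/-- **The rank part of the Birch–Swinnerton-Dyer conjecture holds for a set of elliptic curves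
`E_{A,B} : y² = x³ + Ax + B` over `ℚ` of lower height-density at least
`c_rank = 3059480216411717 / 4576171406400000 = 0.66856766…`, BELOW NAMED FACTS ONLY.**
This is `Pieces.heightDensityGE_satisfiesBSDRankLeOne_cRank` (Bhargava–Skinner–Zhang Cor. 26
assembled with Bhargava–Skinner Thm 7 (ii) on the pieces `S₀(5) ⊇ S₁'(5) ⊔ T₅ ⊔ SP'_K`, `W₅`,
`Z = ker res_v`, every density binder discharged) with its five per-curve class-theorem binders fed
by the landed glue: `h5` = `Pieces.h5_pieces_of_mainConjectures` (BSZ Thm 5: good-ordinary leg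
below `hmod` / `hMC` / `hS` = modularity, Burungale–Castella–Skinner 2025 Thm 1.1.2 (a),
Schneider–Perrin-Riou; multiplicative leg below `hmod'` / `hA` / `hGs` / `hGn` / `hGS` = modular
parametrisation, Skinner 2016 Thm A, Greenberg 1999 §4, Greenberg–Stevens), `h9` =
`Pieces.h9_pieces` (BSZ Thm 9 below `hZ` = W. Zhang 2014 Thm 1.4 (i), `hSZ` = Skinner–Zhang Thm 1.1
— OPEN preprint claim, labelled —, `hCT` = Cassels–Tate), `hker` = `Pieces.hker_pieces`
(unconditional), `hWtors` = `Pieces.hWtors_pieces` (unconditional); the binder `hKim` (C.-H. Kim,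
Math. Ann. 387, Thm 1.1 at the multiplicative prime `5` under (IMC[1/p]), on `SP'_K ∩ W₅` with
`#Sel₅ = 5`, `#Z = 1`) stays an ANONYMOUS hypothesis. Remaining named facts: `hGZK` (A18), `hpar`
(Dokchitser–Dokchitser Thm 1.4, `p_parity`; the capstone's `hDD` is
`even_selmerRank_sub_torsionRank_iff_of_facts hpar hCT`), `hTate` (A230), `hD` (Duke 1997), `h16d`
(A331), `h7` (A329), `h31` (A330). Parameters: `K ≥ 8`, `v ∋ 5`. No density number of record,
mark, tier or K1 word moves by this theorem.
[cite: BhargavaSkinnerZhang2014, Cor 26 (proof, pp. 10–13) with Thms 5, 9, 16, Lemmas 17–20, (2)]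
[cite: BhargavaSkinner2014, Thm 7 (ii), Prop 12 and Lemma 16]
[cite: BhargavaShankar5Selmer2013, Thm 31 and §5] [cite: DokchitserDokchitserAnnals2010, Thm. 1.4]
[cite: WZhang2014, Thm. 1.4 (i) (p. 197)]
[claim: SkinnerZhang2014, status: under-review] [cite: Skinner2016PacificMC, Thm. A]
[cite: BurungaleCastellaSkinner2025, Thm. 1.1.2 (a)] [cite: Kim2022, Thm. 1.1 (§1, p. 3)] -/
theorem bsz_rankLeOne_cRank_of_facts
    (hGZK : rank_eq_analyticRank_of_analyticRank_le_one)
    (hpar : ∀ (W : WeierstrassCurve ℚ) [W.IsElliptic] (p : ℕ) [Fact p.Prime], p_parity W p)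
    (hTate : tateUniformization_points) (hD : Duke1997_exceptionalPrimes_densityZero)
    (h16d : thm16_exists_disjoint_rootNumber_twist_subfamily_of_twistStable)
    (h7 : thm7_selmerResKer_equidistributed) (h31 : thm31_heightAverageOn_card_selmerFive_le_six)
    (hmod : exists_isNewformOf)
    (hMC : burungale_castella_skinner_charIdeal_eq_padicLFunction)
    (hS : Schneider1985_order_charGenerator)
    (hmod' : nonempty_modularParametrizationData)
    (hA : Skinner2016.thmA_charIdeal_multiplicative)
    (hGs : Greenberg1999.thm41Analogue_charValue_rankZero_split_baseChange_anyPrime)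
    (hGn : Greenberg1999.thm41Analogue_charValue_rankZero_numberField_anyPrime)
    (hGS : haveI : Fact (Nat.Prime 5) := ⟨Nat.prime_five⟩
      ∀ (V : WeierstrassCurve ℚ) [V.IsElliptic] [V.IsGloballyMinimal],
        greenberg_stevens (W := V) (p := 5))
    (hZ : WZhang2014.thm14i_rank_one_of_selmerCorank_eq_one)
    (hSZ : SkinnerZhang2014.thm1_1_rank_one_of_selmerCorank_eq_one_OPEN)
    (hCT : exists_casselsTate_pairing (K := ℚ))
    {K : ℕ} (hK : 8 ≤ K) {v : HeightOneSpectrum (𝓞 ℚ)} (hv : ((5 : ℕ) : 𝓞 ℚ) ∈ v.asIdeal)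
    (hKim : ∀ AB, IsInHeightFamily AB → SP' K AB → W₅ AB →
      Nat.card ((shortWeierstrass AB).selmerGroup 5) = 5 → Nat.card (Z v AB) = 1 →
        (shortWeierstrass AB).mordellWeilRank = 1 ∧ (shortWeierstrass AB).analyticRank = 1) :
    HeightDensityGE SatisfiesBSDRankLeOne (3059480216411717 / 4576171406400000) :=
  haveI : Fact (Nat.Prime 5) := ⟨Nat.prime_five⟩
  heightDensityGE_satisfiesBSDRankLeOne_cRank hGZK
    (even_selmerRank_sub_torsionRank_iff_of_facts hpar hCT) hTate hD h16d h7 h31 hK hv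
    (h5_pieces_of_mainConjectures hmod hMC hS hmod' hA hGs hGn hGS) (h9_pieces hZ hSZ hCT)
    (hker_pieces hv K) hKim hWtors_pieces

/-- **The same theorem with `h5` below ONE hypothesis** `hC` = Skinner 2016 Thm C clause (2) AS
PRINTED (registry A324) in place of `hmod hMC hS hmod' hA hGs hGn hGS` ([BSZ] Rem. 8;
`Pieces.h5_pieces_of_thmC`).
[cite: BhargavaSkinnerZhang2014, Cor 26 (proof, pp. 10–13), Thm 5 and Rem. 8]
[cite: Skinner2016PacificMC, Thm. C (§1, p. 173), second clause]
[cite: WZhang2014, Thm. 1.4 (i) (p. 197)] [claim: SkinnerZhang2014, status: under-review]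
[cite: Kim2022, Thm. 1.1 (§1, p. 3)] -/
theorem bsz_rankLeOne_cRank_of_facts_of_thmC
    (hGZK : rank_eq_analyticRank_of_analyticRank_le_one)
    (hpar : ∀ (W : WeierstrassCurve ℚ) [W.IsElliptic] (p : ℕ) [Fact p.Prime], p_parity W p)
    (hTate : tateUniformization_points) (hD : Duke1997_exceptionalPrimes_densityZero)
    (h16d : thm16_exists_disjoint_rootNumber_twist_subfamily_of_twistStable)
    (h7 : thm7_selmerResKer_equidistributed) (h31 : thm31_heightAverageOn_card_selmerFive_le_six)
    (hC : Skinner2016.thmC_one_le_selmerCorank_of_L_one_eq_zero)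
    (hZ : WZhang2014.thm14i_rank_one_of_selmerCorank_eq_one)
    (hSZ : SkinnerZhang2014.thm1_1_rank_one_of_selmerCorank_eq_one_OPEN)
    (hCT : exists_casselsTate_pairing (K := ℚ))
    {K : ℕ} (hK : 8 ≤ K) {v : HeightOneSpectrum (𝓞 ℚ)} (hv : ((5 : ℕ) : 𝓞 ℚ) ∈ v.asIdeal)
    (hKim : ∀ AB, IsInHeightFamily AB → SP' K AB → W₅ AB →
      Nat.card ((shortWeierstrass AB).selmerGroup 5) = 5 → Nat.card (Z v AB) = 1 →
        (shortWeierstrass AB).mordellWeilRank = 1 ∧ (shortWeierstrass AB).analyticRank = 1) :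
    HeightDensityGE SatisfiesBSDRankLeOne (3059480216411717 / 4576171406400000) :=
  haveI : Fact (Nat.Prime 5) := ⟨Nat.prime_five⟩
  heightDensityGE_satisfiesBSDRankLeOne_cRank hGZK
    (even_selmerRank_sub_torsionRank_iff_of_facts hpar hCT) hTate hD h16d h7 h31 hK hv
    (h5_pieces_of_thmC hC) (h9_pieces hZ hSZ hCT) (hker_pieces hv K) hKim hWtors_pieces

/-- **The same theorem at `K = 8`, with the place `v ∋ 5` taken inside** and the anonymous binder
`hKim` asked at every place of `ℚ` above `5` (there is exactly one).
[cite: BhargavaSkinnerZhang2014, Cor 26 (proof, pp. 10–13), Thm 5 and Rem. 8]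
[cite: Skinner2016PacificMC, Thm. C (§1, p. 173), second clause]
[cite: WZhang2014, Thm. 1.4 (i) (p. 197)] [claim: SkinnerZhang2014, status: under-review]
[cite: Kim2022, Thm. 1.1 (§1, p. 3)] -/
theorem bsz_rankLeOne_cRank_of_facts_of_thmC_K8
    (hGZK : rank_eq_analyticRank_of_analyticRank_le_one)
    (hpar : ∀ (W : WeierstrassCurve ℚ) [W.IsElliptic] (p : ℕ) [Fact p.Prime], p_parity W p)
    (hTate : tateUniformization_points) (hD : Duke1997_exceptionalPrimes_densityZero)
    (h16d : thm16_exists_disjoint_rootNumber_twist_subfamily_of_twistStable)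
    (h7 : thm7_selmerResKer_equidistributed) (h31 : thm31_heightAverageOn_card_selmerFive_le_six)
    (hC : Skinner2016.thmC_one_le_selmerCorank_of_L_one_eq_zero)
    (hZ : WZhang2014.thm14i_rank_one_of_selmerCorank_eq_one)
    (hSZ : SkinnerZhang2014.thm1_1_rank_one_of_selmerCorank_eq_one_OPEN)
    (hCT : exists_casselsTate_pairing (K := ℚ))
    (hKim : ∀ v : HeightOneSpectrum (𝓞 ℚ), ((5 : ℕ) : 𝓞 ℚ) ∈ v.asIdeal →
      ∀ AB, IsInHeightFamily AB → SP' 8 AB → W₅ AB →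
        Nat.card ((shortWeierstrass AB).selmerGroup 5) = 5 → Nat.card (Z v AB) = 1 →
          (shortWeierstrass AB).mordellWeilRank = 1 ∧ (shortWeierstrass AB).analyticRank = 1) :
    HeightDensityGE SatisfiesBSDRankLeOne (3059480216411717 / 4576171406400000) := by
  obtain ⟨v, hv⟩ := exists_heightOneSpectrum_five_mem
  exact bsz_rankLeOne_cRank_of_facts_of_thmC hGZK hpar hTate hD h16d h7 h31 hC hZ hSZ hCT le_rfl hv
    (hKim v hv)

end Literature.NumberTheory.EllipticCurves.BhargavaSkinnerZhang2014

end
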